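import Literature.AlgebraicGeometry.Surfaces.K3SurfaceBuskinLeaves
import Literature.AlgebraicGeometry.HodgeTheory.AlgebraicClassesPullbackHolds
import HarnessLib

/-!
# The cup-product leaf of Buskin's theorem: `N²H⁴ ∪ N²H⁴ ⊆ N⁴H⁸` on a triple product of surfaces — PROVED

Family `hodge`, layer `Literature/AlgebraicGeometry/Surfaces`. THEOREMS ONLY (no definition, no named
fact). Discharge of the named fact `Surfaces.cupProduct_mem_algebraicClasses_tripleProduct_surfaces`
(`K3SurfaceBuskinLeaves`: for smooth projective complex surfaces `A`, `B`, `C` and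
`a, b ∈ N²H⁴((A ⊗ (B ⊗ C))(ℂ); ℂ)`, `a ∪ b ∈ N⁴H⁸` — the hypothesis `hCUP` of
`Buskin2019_hodgeIsometry_algebraic_of_reflective_of_cup`, the instance `(dim; codim, codim) = (6; 2, 2)`
of Voisin II Prop. 9.20 "`cl(Z · Z') = cl(Z) ∪ cl(Z')`"): it is the instance `d = 2 + (2 + 2)`,
`a = b = 2` of the multiplicativity of algebraic classes
`HodgeTheory.Voisin2003_cupProduct_algebraicClasses_holds'` (`AlgebraicClassesPullbackHolds`: diagonal
pull-back of exterior products, with the pull-back of algebraic classes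
`fulton1998_map_mem_algebraicClasses_holds'` — Fulton Cor. 19.2 (b) by deformation to the normal cone).

* `cupProduct_mem_algebraicClasses_tripleProduct_surfaces_holds` — the discharge (exact `<FQN>_holds`).

Summits twin: `Summit.HodgeConjecture.HodgeConjecture.Theorems.cupProduct_mem_algebraicClasses_tripleProduct_surfaces_holds`
(`Theorems/MarkmanPartnerTransportPicardThreeK3SquaresBuskinCupLeaf`, via
`MarkmanPartnerTransport.SquareOfGenerator.cupProduct_mem_algebraicClasses_tripleProduct`), which
`Literature/` may not import. Lane `lit-hodgefound`, seat p20.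

## References

* [VoisinHodgeII2003] C. Voisin, Hodge Theory and Complex Algebraic Geometry II (2003), §9.2.4
  Prop. 9.20, Prop. 9.21 (i).
* [Fulton1998] W. Fulton, Intersection Theory, 2nd ed. (1998), §19.2 Cor. 19.2 (b).
* [Buskin2019] N. Buskin, Every rational Hodge isometry between two K3 surfaces is algebraic,
  J. reine angew. Math. 755 (2019), Thm. 1.1 (the consumer of this leaf).
-/

noncomputable section

open CategoryTheory MonoidalCategory
open Literature.AlgebraicTopology.SingularHomology
open Literature.AlgebraicGeometry.Motives (IsSmoothProjective)

namespace Literature.AlgebraicGeometry.Surfaces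

/-- **`N²H⁴ ∪ N²H⁴ ⊆ N⁴H⁸` on `(A ⊗ (B ⊗ C))(ℂ)` for smooth projective complex surfaces `A`, `B`, `C`**
— the named fact `cupProduct_mem_algebraicClasses_tripleProduct_surfaces`, PROVED: the sixfold
`A ⊗ (B ⊗ C)` is smooth projective (`IsSmoothProjective.tensor_holds`), and cup products of algebraic
classes are algebraic on every smooth projective complex variety
(`HodgeTheory.Voisin2003_cupProduct_algebraicClasses_holds'`).
[cite: VoisinHodgeII2003, §9.2.4 Prop. 9.20 and Prop. 9.21 (i)] [cite: Fulton1998, §19.2 Cor. 19.2 (b)] -/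
theorem cupProduct_mem_algebraicClasses_tripleProduct_surfaces_holds :
    cupProduct_mem_algebraicClasses_tripleProduct_surfaces :=
  fun _ _ _ hA hB hC _ ha _ hb ↦
    HodgeTheory.Voisin2003_cupProduct_algebraicClasses_holds'
      (IsSmoothProjective.tensor_holds hA (IsSmoothProjective.tensor_holds hB hC)) ha hb

end Literature.AlgebraicGeometry.Surfaces

end
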